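import Literature.NumberTheory.EllipticCurves.KellerYin2024.CharacterModulePrufer
import HarnessLib

/-!
# Crux `PrintCf2.SplitBadTwoRankOneOfFacts` (stmt-BirchSwinnertonDyer-20368), skeleton v13.5, registered stub `stub_xRegular_two` = (REG₂), FACT-FREE
# road, θ-BOOKKEEPING glue: THE SIGN CHARACTER `ε : Γ_K →* ℤˣ` OF A QUADRATIC FRAMED CHARACTER `θ` and the `ε`-reading of `A_θ = ℚ₂/ℤ₂(θ)`

Cell `bsd-print-cf2`, EXTRA WIDTH seat `bsd-line-cf2-p1-w4` g14 (prover-bsd-line-cf2-p1-w4-g14-0); `--supports stmt-BirchSwinnertonDyer-20368`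
(helper, Theses-free, Summits-import-free). HONEST FRAMING: nothing here closes the crux or a registered stub; BSD is not proved by any of
this; no summit statement is proved by this seat. No definition, no named fact, no `sorry`. Plumbing only.

WHY. The registered stub (REG₂) and the R2 socket (LSₙ,₂) (-w2 g14 p704095 `XRegPinned.stub_xRegular_two_of_locSurjLayers`) quantify over a
framed character `θ : FramedGaloisRep K 𝓞 1` (`𝓞 = padicCoeffIntegers ∅ ≅ ℤ₂`) with `∀ σ, θ σ ^ 2 = 1`, acting on `A_θ = KellerYin2024.charModule ∅ θ`;
the arithmetic input (PRO-NULL)_U of the level lift (-w3 g13 p703858 / p704411, this seat p705557, p705963) is written for a SIGN CHARACTER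
`ε : Γ_K →* ℤˣ` (twisted cocycles `c(gh) = c(g)·(g•c(h))^{ε g}`, `ε`-twisted readings `ι(g•x) = (g•ι x)^{ε g}`, the field `F′` with
`Gal(K̄/F′) = U ∩ ker ε`, `IsOpen ker ε`). THIS FILE is the bridge `θ ↦ ε`:
* `unitChar_eq_one_or_eq_neg_one` — `θ² = 1 ⟹ unitChar θ σ = ±1` in `ℤ₂ˣ`;
* **`exists_signHom_of_sq_eq_one`** — `∃ ε : Γ_K →* ℤˣ` with (i) `((ε σ : ℤ) : ℤ₂) = unitChar θ σ`, (ii) `ε σ = 1 ↔ unitChar θ σ = 1`,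
  (iii) `IsOpen (ε.ker)` (finite image of the continuous `unitChar θ`, tree `continuousMonoidHom_isOpen_ker_of_finite_range`),
  (iv) **`σ • a = (ε σ : ℤ) • a` on `A_θ`** (tree `charModuleEquiv_galois_smul`);
* `unitChar_eq_one_iff_apply_eq_one` — `unitChar θ σ = 1 ↔ θ σ = 1` (so «`θ` ramified at `w`» = «`∃ τ ∈ I_w, ε τ ≠ 1`», the input of p705557).
presearch: none needed (plumbing between two tree currencies); no new fact. beyond-print theorem: no.

References: [KellerYin2024] §1.1; [Greenberg2006] p. 342.
-/

noncomputable section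

set_option linter.dupNamespace false
set_option autoImplicit false

open scoped Classical
open Field
open Literature.NumberTheory.GaloisRepresentations Literature.NumberTheory.EllipticCurves
open Literature.NumberTheory.EllipticCurves.KellerYin2024 Literature.NumberTheory.IwasawaTheory

namespace Summit.BirchSwinnertonDyer.BirchSwinnertonDyer.Theorems.PrintCf2.KummerUDict

variable {K : Type} [Field K]

/-- `θ² = 1 ⟹ unitChar θ σ ∈ {1, −1}` (`ℤ₂` is a domain). [cite: KellerYin2024, §1.1] -/
theorem unitChar_eq_one_or_eq_neg_one (θ : FramedGaloisRep K (padicCoeffIntegers (∅ : Set (PadicAlgCl 2))) 1)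
    (hθ : ∀ σ : absoluteGaloisGroup K, θ σ ^ 2 = 1) (σ : absoluteGaloisGroup K) :
    unitChar θ σ = 1 ∨ unitChar θ σ = -1 := by
  have h := unitChar_pow_eq_one θ hθ σ
  have h' : ((unitChar θ σ : ℤ_[2]ˣ) : ℤ_[2]) ^ 2 = 1 := by rw [← Units.val_pow_eq_pow_val, h, Units.val_one]
  rcases sq_eq_one_iff.mp h' with h1 | h1
  · exact Or.inl (Units.ext h1)
  · exact Or.inr (Units.ext (by rw [h1, Units.val_neg, Units.val_one]))

/-- `unitChar θ σ = 1 ↔ θ σ = 1` (a `1 × 1` invertible matrix is `1` iff its entry is). [cite: KellerYin2024, §1.1] -/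
theorem unitChar_eq_one_iff_apply_eq_one {p : ℕ} [Fact p.Prime]
    (θ : FramedGaloisRep K (padicCoeffIntegers (∅ : Set (PadicAlgCl p))) 1) (σ : absoluteGaloisGroup K) :
    unitChar θ σ = 1 ↔ θ σ = 1 := by
  have key : ((unitChar θ σ : ℤ_[p]ˣ) : ℤ_[p]) = 1 ↔
      ((θ σ : GL (Fin 1) (padicCoeffIntegers (∅ : Set (PadicAlgCl p)))) :
        Matrix (Fin 1) (Fin 1) (padicCoeffIntegers (∅ : Set (PadicAlgCl p)))) 0 0 = 1 := by
    rw [← (padicIntEquivCoeffIntegersEmpty p).injective.eq_iff, padicIntEquiv_unitChar, map_one]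
  constructor
  · intro h
    have h1 : ((unitChar θ σ : ℤ_[p]ˣ) : ℤ_[p]) = 1 := by rw [h, Units.val_one]
    have h2 := key.mp h1
    apply Units.ext
    ext i j
    rw [Subsingleton.elim i 0, Subsingleton.elim j 0, h2]
    simp
  · intro h
    apply Units.ext
    rw [Units.val_one]
    apply key.mpr
    rw [h]
    simp

/-- **THE SIGN CHARACTER OF A QUADRATIC FRAMED CHARACTER.** For `θ : Γ_K → GL₁(𝓞)` with `θ² = 1` there is `ε : Γ_K →* ℤˣ` with
`((ε σ : ℤ) : ℤ₂) = unitChar θ σ`, `ε σ = 1 ↔ unitChar θ σ = 1`, OPEN kernel, and `σ • a = (ε σ : ℤ) • a` for every `a ∈ A_θ = ℚ₂/ℤ₂(θ)` — the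
`ε` of the twisted (PRO-NULL)_U theorems (p704411, p705557) and of the twisted layer field (p705963). [cite: KellerYin2024, §1.1] [cite: Greenberg2006, p. 342] -/
theorem exists_signHom_of_sq_eq_one (θ : FramedGaloisRep K (padicCoeffIntegers (∅ : Set (PadicAlgCl 2))) 1)
    (hθ : ∀ σ : absoluteGaloisGroup K, θ σ ^ 2 = 1) :
    ∃ ε : absoluteGaloisGroup K →* ℤˣ,
      (∀ σ, (((ε σ : ℤˣ) : ℤ) : ℤ_[2]) = ((unitChar θ σ : ℤ_[2]ˣ) : ℤ_[2])) ∧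
      (∀ σ, ε σ = 1 ↔ unitChar θ σ = 1) ∧
      IsOpen ((ε.ker : Subgroup (absoluteGaloisGroup K)) : Set (absoluteGaloisGroup K)) ∧
      ∀ (σ : absoluteGaloisGroup K) (a : charModule (∅ : Set (PadicAlgCl 2)) θ), σ • a = ((ε σ : ℤˣ) : ℤ) • a := by
  have hne : (-1 : ℤ_[2]ˣ) ≠ 1 := by
    intro h
    have h' := congrArg (fun u : ℤ_[2]ˣ ↦ (u : ℤ_[2])) h
    simp only [Units.val_neg, Units.val_one] at h'
    norm_num at h'
  -- the function and its multiplicativity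
  let f : absoluteGaloisGroup K → ℤˣ := fun σ ↦ if unitChar θ σ = 1 then 1 else -1
  have hf1 : ∀ σ, unitChar θ σ = 1 → f σ = 1 := fun σ h ↦ by simp only [f, if_pos h]
  have hf2 : ∀ σ, unitChar θ σ = -1 → f σ = -1 := fun σ h ↦ by
    simp only [f]
    rw [if_neg (by rw [h]; exact hne)]
  have hmul : ∀ σ τ, f (σ * τ) = f σ * f τ := by
    intro σ τ
    have hστ : unitChar θ (σ * τ) = unitChar θ σ * unitChar θ τ := map_mul _ _ _
    rcases unitChar_eq_one_or_eq_neg_one θ hθ σ with hσ | hσ <;>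
      rcases unitChar_eq_one_or_eq_neg_one θ hθ τ with hτ | hτ
    · rw [hf1 σ hσ, hf1 τ hτ, hf1 _ (by rw [hστ, hσ, hτ, one_mul]), one_mul]
    · rw [hf1 σ hσ, hf2 τ hτ, hf2 _ (by rw [hστ, hσ, hτ, one_mul]), one_mul]
    · rw [hf2 σ hσ, hf1 τ hτ, hf2 _ (by rw [hστ, hσ, hτ, mul_one]), mul_one]
    · rw [hf2 σ hσ, hf2 τ hτ, hf1 _ (by rw [hστ, hσ, hτ, neg_one_mul, neg_neg]), neg_one_mul, neg_neg]
  let ε : absoluteGaloisGroup K →* ℤˣ := MonoidHom.mk' f hmul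
  have hε : ∀ σ, ε σ = f σ := fun _ ↦ rfl
  -- (ii) `ε σ = 1 ↔ unitChar θ σ = 1`
  have hiff : ∀ σ, ε σ = 1 ↔ unitChar θ σ = 1 := fun σ ↦ by
    rw [hε]
    rcases unitChar_eq_one_or_eq_neg_one θ hθ σ with h | h
    · rw [hf1 σ h, h]
      exact ⟨fun _ ↦ rfl, fun _ ↦ rfl⟩
    · rw [hf2 σ h, h]
      constructor
      · intro h0; exact absurd h0 (by decide)
      · intro h0; exact absurd h0 hne
  -- (i) the cast identity
  have hcast : ∀ σ, (((ε σ : ℤˣ) : ℤ) : ℤ_[2]) = ((unitChar θ σ : ℤ_[2]ˣ) : ℤ_[2]) := fun σ ↦ by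
    rw [hε]
    rcases unitChar_eq_one_or_eq_neg_one θ hθ σ with h | h
    · rw [hf1 σ h, h, Units.val_one, Units.val_one, Int.cast_one]
    · rw [hf2 σ h, h, Units.val_neg, Units.val_one, Units.val_neg, Units.val_one, Int.cast_neg, Int.cast_one]
  refine ⟨ε, hcast, hiff, ?_, fun σ a ↦ ?_⟩
  · -- (iii) open kernel = kernel of the continuous `unitChar θ`, which has finite image
    have hker : ((ε.ker : Subgroup (absoluteGaloisGroup K)) : Set (absoluteGaloisGroup K)) =
        (((unitChar θ).toMonoidHom.ker : Subgroup (absoluteGaloisGroup K)) : Set (absoluteGaloisGroup K)) := by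
      ext σ
      simp only [SetLike.mem_coe, MonoidHom.mem_ker, ContinuousMonoidHom.coe_toMonoidHom]
      exact hiff σ
    rw [hker]
    refine continuousMonoidHom_isOpen_ker_of_finite_range (unitChar θ) ?_
    refine ((Set.finite_singleton (-1 : ℤ_[2]ˣ)).insert 1).subset ?_
    rintro _ ⟨σ, rfl⟩
    rcases unitChar_eq_one_or_eq_neg_one θ hθ σ with h | h
    · exact Or.inl h
    · exact Or.inr h
  · -- (iv) the Galois action on `A_θ` is `ε`
    apply (charModuleEquiv θ).injective
    rw [charModuleEquiv_galois_smul, map_zsmul, ← hcast σ, Int.cast_smul_eq_zsmul]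

end Summit.BirchSwinnertonDyer.BirchSwinnertonDyer.Theorems.PrintCf2.KummerUDict

end
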